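import Summits.Ventures.PercRepro.LemmaBColouring

/-!
# Lemma B for a Marica–Schönheim-compatible family; the pointed (`x a`-common) form

For a map `c : Config S → Setoid (Fin k)` call a family `U` of configurations **MS-compatible**
(`MSCompatible c U`) when every difference `σ \ τ` of two members has cell `⊥` and its antipode
`(σ \ τ)ᶜ = σᶜ ⊔ τ` has cell `⊤`. The Marica–Schönheim inequality (`Finset.card_le_card_diffs`,
`|U| ≤ |U \\ U|`) then gives `|U| ≤ topBotCount c` (`card_le_topBotCount_of_msCompatible`): the
antipodes of the differences are distinct `{⊤, ⊥}` pairs.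

The **pointed family** at a cell `x a` of a crossing family (`pointedFamily x c a`) consists of the
`ω` with `⊥ ≠ c ω ≤ x a` whose antipode lies in another cell `x b`, `b ≠ a`: the `x a`-members of the
crossing pairs `{x a, x b}` together with the lower sides of the *n-pairs* `(ρ, x b)`, `⊥ < ρ < x a`.
For monotone `c` it is MS-compatible as soon as every nonzero `ρ ≤ x a` joins every other cell to
`⊤` (`pointedFamily_msCompatible`); for the three crossing partitions of four indices this join
property holds (`cross4_sup_eq_top_of_le`: a nonzero partition below `ab|cd` merges `a, b` or
`c, d`, and either pair is split by `ac|bd` and by `ad|bc`).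

Consequence (`crossCount_add_nPairCount_le_topBotCount`): if every crossing pair of a monotone `c`
contains the cell `x a` (the two-type case), then
`crossCount x c + nPairCount x c a ≤ topBotCount c` — the two-type Lemma B strengthened by the
number of n-pairs pointed at `x a`. This is the «x-pointed B⁺» statement in its two-type case and the
mechanism behind the x-monochromatic half of the MIN-FACE dichotomy
(`HOME/proofs/P4-components.md` §14, lead 08:58:15Z / 08:59:42Z): the bottom face pays its
both-pivotal pairs through Marica–Schönheim differences.
-/

namespace PercRepro

open Finset
open scoped FinsetFamily

section MS

variable {S : Type*} [Fintype S] [DecidableEq S] {k r : ℕ}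

/-- `U` is **Marica–Schönheim-compatible** for `c`: every difference `σ \ τ` of two members has
cell `⊥` and its antipode has cell `⊤`. -/
def MSCompatible (c : Config S → Setoid (Fin k)) (U : Finset (Config S)) : Prop :=
  ∀ σ ∈ U, ∀ τ ∈ U, c (σ \ τ) = ⊥ ∧ c (σ \ τ)ᶜ = ⊤

/-- **Marica–Schönheim bound**: an MS-compatible family has at most `topBotCount c` members
(its differences are the `⊥`-sides of distinct `{⊤, ⊥}` antipodal pairs). -/
theorem card_le_topBotCount_of_msCompatible (c : Config S → Setoid (Fin k))
    (U : Finset (Config S)) (hU : MSCompatible c U) : U.card ≤ topBotCount c := by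
  classical
  have h1 : U.card ≤ (U \\ U).card := Finset.card_le_card_diffs U
  have h2 : (U \\ U).image compl ⊆ goodSet c := by
    intro ρ hρ
    rw [Finset.mem_image] at hρ
    obtain ⟨δ, hδ, rfl⟩ := hρ
    rw [Finset.mem_diffs] at hδ
    obtain ⟨σ, hσ, τ, hτ, rfl⟩ := hδ
    obtain ⟨hb, ht⟩ := hU σ hσ τ hτ
    unfold goodSet
    rw [Finset.mem_filter, compl_compl]
    exact ⟨Finset.mem_univ _, ht, hb⟩
  have h3 : ((U \\ U).image compl).card = (U \\ U).card :=
    Finset.card_image_of_injective _ compl_injective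
  rw [topBotCount_eq_card_goodSet]
  calc U.card ≤ (U \\ U).card := h1
    _ = ((U \\ U).image compl).card := h3.symm
    _ ≤ (goodSet c).card := Finset.card_le_card h2

open Classical in
/-- The **pointed family** at the cell `x a`: `ω` with `⊥ ≠ c ω ≤ x a` whose antipode lies in
another cell `x b`, `b ≠ a` (the `x a`-members of crossing pairs and the lower sides of n-pairs
pointed at `x a`). -/
noncomputable def pointedFamily (x : Fin r → Setoid (Fin k)) (c : Config S → Setoid (Fin k))
    (a : Fin r) : Finset (Config S) :=
  univ.filter fun ω => c ω ≠ ⊥ ∧ c ω ≤ x a ∧ ∃ b, b ≠ a ∧ c ωᶜ = x b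

/-- Membership in the pointed family at the cell `x a`. -/
theorem mem_pointedFamily {x : Fin r → Setoid (Fin k)} {c : Config S → Setoid (Fin k)}
    {a : Fin r} {ω : Config S} :
    ω ∈ pointedFamily x c a ↔ c ω ≠ ⊥ ∧ c ω ≤ x a ∧ ∃ b, b ≠ a ∧ c ωᶜ = x b := by
  classical
  simp only [pointedFamily, Finset.mem_filter, Finset.mem_univ, true_and]

/-- The pointed family of a monotone map is MS-compatible, provided every nonzero cell below `x a`
joins every other cell of the family to `⊤`. -/
theorem pointedFamily_msCompatible (x : Fin r → Setoid (Fin k)) (hx : IsCrossingFamily x)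
    (c : Config S → Setoid (Fin k)) (hc : Monotone c) (a : Fin r)
    (hsup : ∀ ρ : Setoid (Fin k), ρ ≠ ⊥ → ρ ≤ x a → ∀ b, b ≠ a → x b ⊔ ρ = ⊤) :
    MSCompatible c (pointedFamily x c a) := by
  intro σ hσ τ hτ
  rw [mem_pointedFamily] at hσ hτ
  obtain ⟨-, hσa, b, hba, hσb⟩ := hσ
  obtain ⟨hτ0, hτa, b', hb'a, hτb'⟩ := hτ
  constructor
  · refine le_antisymm ?_ bot_le
    have h1 : c (σ \ τ) ≤ c σ := hc sdiff_le
    have h2 : c (σ \ τ) ≤ c τᶜ := hc (by rw [sdiff_eq]; exact inf_le_right)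
    calc c (σ \ τ) ≤ c σ ⊓ c τᶜ := le_inf h1 h2
      _ ≤ x a ⊓ x b' := inf_le_inf hσa (le_of_eq hτb')
      _ = ⊥ := hx.inf_eq_bot (Ne.symm hb'a)
  · refine le_antisymm le_top ?_
    have e : (σ \ τ)ᶜ = σᶜ ⊔ τ := by rw [sdiff_eq, compl_inf, compl_compl]
    rw [e]
    have h1 : c σᶜ ≤ c (σᶜ ⊔ τ) := hc le_sup_left
    have h2 : c τ ≤ c (σᶜ ⊔ τ) := hc le_sup_right
    rw [hσb] at h1
    calc (⊤ : Setoid (Fin k)) = x b ⊔ c τ := (hsup (c τ) hτ0 hτa b hba).symm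
      _ ≤ c (σᶜ ⊔ τ) := sup_le h1 h2

/-- The pointed family is at most the number of `{⊤, ⊥}` antipodal pairs. -/
theorem card_pointedFamily_le_topBotCount (x : Fin r → Setoid (Fin k)) (hx : IsCrossingFamily x)
    (c : Config S → Setoid (Fin k)) (hc : Monotone c) (a : Fin r)
    (hsup : ∀ ρ : Setoid (Fin k), ρ ≠ ⊥ → ρ ≤ x a → ∀ b, b ≠ a → x b ⊔ ρ = ⊤) :
    (pointedFamily x c a).card ≤ topBotCount c :=
  card_le_topBotCount_of_msCompatible c _ (pointedFamily_msCompatible x hx c hc a hsup)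

end MS

/-! ### The join property for the three crossing partitions of four indices -/

/-- A setoid on `Fin 4` relating some `u` to everything is `⊤`. -/
theorem Setoid.eq_top_of_rel_all_fin4 (s : Setoid (Fin 4)) (u : Fin 4) (h : ∀ w, s u w) :
    s = ⊤ :=
  Setoid.eq_top_iff.2 fun x y => s.trans (s.symm (h x)) (h y)

/-- Two indices in different blocks of `cross4 b` have blocks covering all four indices. -/
theorem cross4_cover {b : Fin 3} {u v : Fin 4} (huv : ¬ cross4 b u v) (w : Fin 4) :
    cross4 b u w ∨ cross4 b v w := by
  rw [cross4_rel] at huv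
  rw [cross4_rel, cross4_rel]
  fin_cases b <;> fin_cases u <;> fin_cases v <;> fin_cases w <;> simp at huv ⊢

/-- The crossing partitions are not discrete. -/
theorem cross4_ne_bot (a : Fin 3) : cross4 a ≠ ⊥ := by
  intro h
  have h1 : cross4 a 0 1 ∨ cross4 a 0 2 ∨ cross4 a 0 3 := by
    rw [cross4_rel, cross4_rel, cross4_rel]
    fin_cases a <;> simp
  rw [h] at h1
  rcases h1 with h1 | h1 | h1
  · exact (by decide : (0 : Fin 4) ≠ 1) h1
  · exact (by decide : (0 : Fin 4) ≠ 2) h1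
  · exact (by decide : (0 : Fin 4) ≠ 3) h1

/-- **Join property**: a nonzero partition below `cross4 a` joins every other crossing partition
to `⊤` (it merges two indices of one block of `cross4 a`, which lie in different blocks of
`cross4 b`; the two `cross4 b`-blocks then cover all four indices). -/
theorem cross4_sup_eq_top_of_le {a b : Fin 3} (hba : b ≠ a) {ρ : Setoid (Fin 4)} (h0 : ρ ≠ ⊥)
    (hρ : ρ ≤ cross4 a) : cross4 b ⊔ ρ = ⊤ := by
  have hex : ∃ u v : Fin 4, u ≠ v ∧ ρ u v := by
    by_contra h
    apply h0
    refine le_antisymm ?_ bot_le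
    rw [Setoid.le_def]
    intro x y hxy
    show x = y
    by_contra hne
    exact h ⟨x, y, hne, hxy⟩
  obtain ⟨u, v, huv, hρuv⟩ := hex
  have hav : cross4 a u v := Setoid.le_def.1 hρ hρuv
  have hbv : ¬ cross4 b u v := by
    intro hb
    have hinf : (cross4 a ⊓ cross4 b) u v := ⟨hav, hb⟩
    rw [cross4_inf_eq_bot (Ne.symm hba)] at hinf
    exact huv hinf
  have hall : ∀ w, (cross4 b ⊔ ρ) u w := by
    intro w
    rcases cross4_cover hbv w with h | h
    · exact Setoid.le_def.1 (le_sup_left : cross4 b ≤ cross4 b ⊔ ρ) h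
    · exact (cross4 b ⊔ ρ).trans
        (Setoid.le_def.1 (le_sup_right : ρ ≤ cross4 b ⊔ ρ) hρuv)
        (Setoid.le_def.1 (le_sup_left : cross4 b ≤ cross4 b ⊔ ρ) h)
  exact Setoid.eq_top_of_rel_all_fin4 _ u hall

/-! ### The two-type pointed bound -/

section Pointed

variable {S : Type*} [Fintype S] [DecidableEq S] {k r : ℕ}

open Classical in
/-- The number of **n-pairs pointed at `x a`**: antipodal pairs `{ω, ωᶜ}` with `⊥ < c ω < x a` and
`c ωᶜ` another cell `x b`, `b ≠ a` (counted by the lower member `ω`). -/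
noncomputable def nPairCount (x : Fin r → Setoid (Fin k)) (c : Config S → Setoid (Fin k))
    (a : Fin r) : ℕ :=
  (univ.filter fun ω : Config S => c ω ≠ ⊥ ∧ c ω < x a ∧ ∃ b, b ≠ a ∧ c ωᶜ = x b).card

/-- **Two-type pointed Lemma B.** If every crossing pair of the monotone map `c` contains the cell
`x a` and every nonzero cell below `x a` joins every other cell to `⊤`, then
`crossCount x c + nPairCount x c a ≤ topBotCount c`. -/
theorem crossCount_add_nPairCount_le_topBotCount (x : Fin r → Setoid (Fin k))
    (hx : IsCrossingFamily x) (c : Config S → Setoid (Fin k)) (hc : Monotone c) (a : Fin r)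
    (hbot : x a ≠ ⊥)
    (hsup : ∀ ρ : Setoid (Fin k), ρ ≠ ⊥ → ρ ≤ x a → ∀ b, b ≠ a → x b ⊔ ρ = ⊤)
    (hcommon : ∀ ω : Config S, ∀ i j : Fin r, i < j → c ω = x i → c ωᶜ = x j → i = a ∨ j = a) :
    crossCount x c + nPairCount x c a ≤ topBotCount c := by
  classical
  -- the `x a`-members of the crossing pairs
  set A : Finset (Config S) := (badSet x c).image fun ω => if c ω = x a then ω else ωᶜ with hA
  -- the lower sides of the pointed n-pairs
  set B : Finset (Config S) :=
    univ.filter fun ω : Config S => c ω ≠ ⊥ ∧ c ω < x a ∧ ∃ b, b ≠ a ∧ c ωᶜ = x b with hB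
  have hAcard : A.card = (badSet x c).card := by
    rw [hA]
    refine Finset.card_image_of_injOn ?_
    intro ω hω ω' hω' heq
    change (if c ω = x a then ω else ωᶜ) = (if c ω' = x a then ω' else ω'ᶜ) at heq
    have hωb : ω ∈ badSet x c := hω
    have hω'b : ω' ∈ badSet x c := hω'
    by_cases h : c ω = x a <;> by_cases h' : c ω' = x a
    · rw [if_pos h, if_pos h'] at heq; exact heq
    · rw [if_pos h, if_neg h'] at heq
      exfalso
      apply not_mem_badSet_compl hx.injective hωb
      rw [heq, compl_compl]; exact hω'b
    · rw [if_neg h, if_pos h'] at heq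
      exfalso
      apply not_mem_badSet_compl hx.injective hω'b
      rw [← heq, compl_compl]; exact hωb
    · rw [if_neg h, if_neg h'] at heq
      exact compl_injective heq
  have hAsub : A ⊆ pointedFamily x c a := by
    intro ρ hρ
    rw [hA, Finset.mem_image] at hρ
    obtain ⟨ω, hω, rfl⟩ := hρ
    unfold badSet at hω
    rw [Finset.mem_filter] at hω
    obtain ⟨-, i, j, hij, h1, h2⟩ := hω
    rw [mem_pointedFamily]
    by_cases h : c ω = x a
    · rw [if_pos h]
      have hia : i = a := hx.injective (h1.symm.trans h)
      refine ⟨h ▸ hbot, le_of_eq h, j, ?_, h2⟩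
      rw [← hia]; exact (ne_of_lt hij).symm
    · rw [if_neg h]
      rcases hcommon ω i j hij h1 h2 with hia | hja
      · exact absurd (hia ▸ h1) h
      · rw [compl_compl]
        refine ⟨by rw [h2, hja]; exact hbot, le_of_eq (by rw [h2, hja]), i, ?_, h1⟩
        rw [← hja]; exact ne_of_lt hij
  have hBsub : B ⊆ pointedFamily x c a := by
    intro ω hω
    rw [hB, Finset.mem_filter] at hω
    obtain ⟨-, h0, hlt, b, hba, hb⟩ := hω
    rw [mem_pointedFamily]
    exact ⟨h0, le_of_lt hlt, b, hba, hb⟩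
  have hdisj : Disjoint A B := by
    rw [Finset.disjoint_left]
    intro ρ hρA hρB
    rw [hB, Finset.mem_filter] at hρB
    obtain ⟨-, -, hlt, -⟩ := hρB
    rw [hA, Finset.mem_image] at hρA
    obtain ⟨ω, hω, rfl⟩ := hρA
    unfold badSet at hω
    rw [Finset.mem_filter] at hω
    obtain ⟨-, i, j, hij, h1, h2⟩ := hω
    by_cases h : c ω = x a
    · rw [if_pos h] at hlt; exact lt_irrefl _ (h ▸ hlt)
    · rw [if_neg h] at hlt
      rcases hcommon ω i j hij h1 h2 with hia | hja
      · exact absurd (hia ▸ h1) h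
      · rw [h2, hja] at hlt
        exact lt_irrefl _ hlt
  have hunion : (A ∪ B).card ≤ (pointedFamily x c a).card :=
    Finset.card_le_card (Finset.union_subset hAsub hBsub)
  rw [Finset.card_union_of_disjoint hdisj, hAcard] at hunion
  rw [crossCount_eq_card_badSet]
  change (badSet x c).card + B.card ≤ topBotCount c
  exact hunion.trans (card_pointedFamily_le_topBotCount x hx c hc a hsup)

/-- **Two-type pointed Lemma B for the three crossing partitions of four indices.** -/
theorem crossCount_add_nPairCount_le_topBotCount_cross4 (c : Config S → Setoid (Fin 4))
    (hc : Monotone c) (a : Fin 3)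
    (hcommon : ∀ ω : Config S, ∀ i j : Fin 3, i < j → c ω = cross4 i → c ωᶜ = cross4 j →
      i = a ∨ j = a) :
    crossCount cross4 c + nPairCount cross4 c a ≤ topBotCount c :=
  crossCount_add_nPairCount_le_topBotCount cross4 cross4_isCrossingFamily c hc a (cross4_ne_bot a)
    (fun _ h0 hρ _ hba => cross4_sup_eq_top_of_le hba h0 hρ) hcommon

end Pointed

end PercRepro
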